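import Mathlib
import HarnessLib

/-!
# Zhang (2022), rescue bed (D-0124 (3)/(4)): a-priori FLOORS of the E108 bed statistic `C(N) = λ_max(K_N)/W`
# (bed node G2-02 / N3-D «E108»; GAP-TABLE row G-21 LEVEL datum) — kernel twin of the quantifier's bookkeeping

Topic `Literature/NumberTheory/LFunctions/Zhang2022` (Landau–Siegel audit tree; verdict-neutral).
Y. Zhang, *Discrete mean estimates and the Landau–Siegel zero*, arXiv:2211.02515v1 (2022)
[Zhang2022LandauSiegel] — **an unrefereed manuscript under adjudication; nothing in this file asserts or
denies any of its claims, and nothing here is a claim about Landau–Siegel zeros, characters or the large sieve.**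

Pure finite linear algebra over `ℂ`, drafted by ls-rescue-quant-1 g2 (scratch `E108Floors.lean` 25d6f602358bc1f7)
and re-homed here (typ-2). The objects are the bed's own (spec bed3-addons block E108, `K_matrix`; typed companions
`Repair.Bed.coefBlockMeanB` / `discWeightB` of `RepairBedBlocks`, `Repair.BandMeanValue` of `RepairBandMeanValue`):

* a finite family `ι` of sampled zeros with nonnegative weights `w i` (`w = |Re 𝔠*·Re ω|`), `W = Σ_i w i`;
* for each zero a vector `u i : κ → ℂ` on the band index set `κ = {⌈P⌉ ≤ n < N}` with UNIT-MODULUS entries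
  (`(u)_n = ψ(n)n^{1/2−ρ}`, `|u_n| = 1` on the critical line — the spec's `K_matrix` clause);
* the weighted discrete mean-value form `Q a = Σ_i w_i‖Σ_n conj(u i n) a n‖² = a*K_N a`, `K_N = Σ_i w_i u_i u_i*`;
  the bed's `C(N)` is `sup_a Q a/(W‖a‖²)`.

Kernel facts (each a one-line identity a BED-ROW / GAP cell quotes): `Q_single`/`nsq_single` (diagonal floor
`C(N) ≥ 1`), `trace_eq` (`Σ_n K_N(n,n) = W·#κ`), `rankOne_floor` / `rankOne_floor_rayleigh` (single-zero floor:
`C(N) ≥ (w_max/W)·#κ`), `exists_weight_ge_avg` / `exists_rayleigh_ge_rank_floor` (the rank floor `#κ/#ι` without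
spectral theory), `sum_sq_le_max_mul` (the participation floor is dominated by the single-zero floor).
Reading (MODEL-SCALED, quant-1's pen): the ALL-COEFFICIENT level `C(N)` is bounded below by `max(1, (w_max/W)·#κ)` by
linear algebra alone; only the excess over that floor, and the CLASS-restricted `C_class`, carry information.
«The programme SEARCHES and TYPES; no claim about Landau–Siegel zeros, Theorems 1–2 of arXiv:2211.02515 or a repaired
Margin232 until a kernel theorem says so.»

## References

* Y. Zhang, arXiv:2211.02515v1 (2022), §2 (2.16), §7 (7.2) p.44 (the discrete mean whose band piece E-108 prices).
  [cite: Zhang2022LandauSiegel, §2 (2.16); §7 (7.2)]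
-/

open Finset

open scoped BigOperators ComplexConjugate

noncomputable section

namespace Literature.NumberTheory.LFunctions.Zhang2022.Repair.Bed.E108


variable {ι κ : Type*} [Fintype ι] [Fintype κ]

/-- Total weight `W = Σ_i w_i` of the sampled zero table.
[cite: Zhang2022LandauSiegel, §2 (2.16); §7 (7.2) p.44] -/
def W (w : ι → ℝ) : ℝ := ∑ i, w i

/-- Squared `ℓ²` norm of a coefficient vector on the band index set.
[cite: Zhang2022LandauSiegel, §2 (2.16); §7 (7.2) p.44] -/
def nsq (a : κ → ℂ) : ℝ := ∑ n, ‖a n‖ ^ 2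

/-- The weighted discrete mean-value form of the E108 node: `Q w u a = Σ_i w_i ‖Σ_n conj(u i n) · a n‖²` (`= a* K_N a`).
[cite: Zhang2022LandauSiegel, §2 (2.16); §7 (7.2) p.44] -/
def Q (w : ι → ℝ) (u : ι → κ → ℂ) (a : κ → ℂ) : ℝ :=
  ∑ i, w i * ‖∑ n, conj (u i n) * a n‖ ^ 2

/-- The Gram kernel `K_N(n, m) = Σ_i w_i · u_i(n) · conj(u_i(m))` (spec `K_matrix`).
[cite: Zhang2022LandauSiegel, §2 (2.16); §7 (7.2) p.44] -/
def K (w : ι → ℝ) (u : ι → κ → ℂ) (n m : κ) : ℂ :=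
  ∑ i, (w i : ℂ) * u i n * conj (u i m)

/-- Unit-modulus entries: `‖u i n‖ = 1` for every zero `i` and band index `n` (critical-line clause of the spec).
[cite: Zhang2022LandauSiegel, §2 (2.16); §7 (7.2) p.44] -/
def UnitModulus (u : ι → κ → ℂ) : Prop := ∀ i n, ‖u i n‖ = 1

omit [Fintype ι] in
/-- The inner sum of `Q` at the zero's OWN vector is the dimension: `Σ_n conj(u j n) u j n = #κ`.
[cite: Zhang2022LandauSiegel, §2 (2.16); §7 (7.2) p.44] -/
theorem inner_self_eq_card {u : ι → κ → ℂ} (hu : UnitModulus u) (j : ι) :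
    ∑ n, conj (u j n) * u j n = (Fintype.card κ : ℂ) := by
  have h : ∀ n, conj (u j n) * u j n = (1 : ℂ) := by
    intro n
    rw [Complex.conj_mul', hu j n]
    norm_num
  simp [h]

omit [Fintype ι] in
/-- `‖u j‖² = #κ` for a unit-modulus vector.
[cite: Zhang2022LandauSiegel, §2 (2.16); §7 (7.2) p.44] -/
theorem nsq_eq_card {u : ι → κ → ℂ} (hu : UnitModulus u) (j : ι) :
    nsq (u j) = (Fintype.card κ : ℝ) := by
  unfold nsq
  simp [hu j]

/-- **Single-zero (rank-one) floor.** At the vector of zero `j` itself, `Q ≥ w_j · (#κ)²`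
(drop the nonnegative terms `i ≠ j`; the `j`-term is `w_j |Σ_n |u j n|²|² = w_j (#κ)²`).
[cite: Zhang2022LandauSiegel, §2 (2.16); §7 (7.2) p.44] -/
theorem rankOne_floor {w : ι → ℝ} (hw : ∀ i, 0 ≤ w i) {u : ι → κ → ℂ} (hu : UnitModulus u) (j : ι) :
    w j * (Fintype.card κ : ℝ) ^ 2 ≤ Q w u (u j) := by
  unfold Q
  have hterm : w j * (Fintype.card κ : ℝ) ^ 2 = w j * ‖∑ n, conj (u j n) * u j n‖ ^ 2 := by
    rw [inner_self_eq_card hu j]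
    simp
  rw [hterm]
  apply Finset.single_le_sum (f := fun i => w i * ‖∑ n, conj (u i n) * u j n‖ ^ 2)
  · intro i _
    exact mul_nonneg (hw i) (by positivity)
  · exact Finset.mem_univ j

/-- The single-zero floor in Rayleigh-quotient form: `w_j · #κ · ‖u j‖² ≤ Q (u j)`, i.e. `C(N) ≥ (w_j/W)·#κ` for every `j`.
[cite: Zhang2022LandauSiegel, §2 (2.16); §7 (7.2) p.44] -/
theorem rankOne_floor_rayleigh {w : ι → ℝ} (hw : ∀ i, 0 ≤ w i) {u : ι → κ → ℂ} (hu : UnitModulus u) (j : ι) :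
    w j * (Fintype.card κ : ℝ) * nsq (u j) ≤ Q w u (u j) := by
  rw [nsq_eq_card hu j, mul_assoc, ← sq]
  exact rankOne_floor hw hu j

/-- **Diagonal floor.** At the unit coordinate vector `e_{n₀}`: `Q = W` …
[cite: Zhang2022LandauSiegel, §2 (2.16); §7 (7.2) p.44] -/
theorem Q_single {w : ι → ℝ} {u : ι → κ → ℂ} (hu : UnitModulus u) [DecidableEq κ] (n₀ : κ) :
    Q w u (Pi.single n₀ 1) = W w := by
  unfold Q W
  congr 1
  ext i
  have : ∑ n, conj (u i n) * (Pi.single n₀ (1 : ℂ) : κ → ℂ) n = conj (u i n₀) := by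
    rw [Finset.sum_eq_single n₀]
    · simp
    · intro n _ hn
      simp [hn]
    · intro h; exact absurd (Finset.mem_univ n₀) h
  rw [this, Complex.norm_conj, hu i n₀]
  simp

/-- … and `‖e_{n₀}‖² = 1`, so `C(N) ≥ Q(e_{n₀})/(W ‖e_{n₀}‖²) = 1`.
[cite: Zhang2022LandauSiegel, §2 (2.16); §7 (7.2) p.44] -/
theorem nsq_single [DecidableEq κ] (n₀ : κ) : nsq (Pi.single n₀ (1 : ℂ) : κ → ℂ) = 1 := by
  unfold nsq
  rw [Finset.sum_eq_single n₀]
  · simp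
  · intro n _ hn
    simp [hn]
  · intro h; exact absurd (Finset.mem_univ n₀) h

/-- **Trace identity** behind the rank floor: `Σ_n K_N(n,n) = W · #κ` (each diagonal entry is `Σ_i w_i |u i n|² = W`).
[cite: Zhang2022LandauSiegel, §2 (2.16); §7 (7.2) p.44] -/
theorem trace_eq {w : ι → ℝ} {u : ι → κ → ℂ} (hu : UnitModulus u) :
    ∑ n, K w u n n = (W w : ℂ) * (Fintype.card κ : ℂ) := by
  have hdiag : ∀ n, K w u n n = (W w : ℂ) := by
    intro n
    unfold K W
    rw [Complex.ofReal_sum]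
    congr 1
    ext i
    rw [mul_assoc, Complex.mul_conj', hu i n]
    simp
  simp [hdiag, mul_comm]

/-- **Pigeonhole on the weights**: some zero carries at least the average weight, `W/#ι ≤ w j`. Hence the single-zero
floor is itself `≥ (#κ)/(#ι)` — the rank floor for `#ι ≤ #κ` needs no spectral theory.
[cite: Zhang2022LandauSiegel, §2 (2.16); §7 (7.2) p.44] -/
theorem exists_weight_ge_avg [Nonempty ι] (w : ι → ℝ) :
    ∃ j, W w / (Fintype.card ι : ℝ) ≤ w j := by
  obtain ⟨j, -, hj⟩ := Finset.exists_le_of_sum_le (s := Finset.univ) Finset.univ_nonempty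
    (f := fun _ => W w / (Fintype.card ι : ℝ)) (g := w) (by
      rw [Finset.sum_const, Finset.card_univ, nsmul_eq_mul]
      have hι : (0 : ℝ) < Fintype.card ι := by exact_mod_cast Fintype.card_pos
      rw [mul_div_cancel₀ _ hι.ne']
      rfl)
  exact ⟨j, hj⟩

/-- Combined: some zero's own vector has Rayleigh quotient `≥ (W/#ι)·#κ`, i.e. `C(N) ≥ #κ/#ι = (N − ⌈P⌉)/F`.
[cite: Zhang2022LandauSiegel, §2 (2.16); §7 (7.2) p.44] -/
theorem exists_rayleigh_ge_rank_floor [Nonempty ι] {w : ι → ℝ} (hw : ∀ i, 0 ≤ w i) {u : ι → κ → ℂ}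
    (hu : UnitModulus u) :
    ∃ j, W w / (Fintype.card ι : ℝ) * (Fintype.card κ : ℝ) * nsq (u j) ≤ Q w u (u j) := by
  obtain ⟨j, hj⟩ := exists_weight_ge_avg w
  refine ⟨j, le_trans ?_ (rankOne_floor_rayleigh hw hu j)⟩
  have hκ : (0 : ℝ) ≤ (Fintype.card κ : ℝ) * nsq (u j) := by
    apply mul_nonneg (by positivity)
    unfold nsq; positivity
  calc W w / (Fintype.card ι : ℝ) * (Fintype.card κ : ℝ) * nsq (u j)
      = W w / (Fintype.card ι : ℝ) * ((Fintype.card κ : ℝ) * nsq (u j)) := by ring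
    _ ≤ w j * ((Fintype.card κ : ℝ) * nsq (u j)) := mul_le_mul_of_nonneg_right hj hκ
    _ = w j * (Fintype.card κ : ℝ) * nsq (u j) := by ring

/-- **Participation floor is dominated**: `Σ_i w_i² ≤ w_max · W` whenever `w_i ≤ w_max` for all `i`; with
`F_eff := W²/Σ w_i²` this reads `#κ/F_eff ≤ (w_max/W)·#κ`.
[cite: Zhang2022LandauSiegel, §2 (2.16); §7 (7.2) p.44] -/
theorem sum_sq_le_max_mul {w : ι → ℝ} (hw : ∀ i, 0 ≤ w i) {wmax : ℝ} (hmax : ∀ i, w i ≤ wmax) :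
    ∑ i, w i ^ 2 ≤ wmax * W w := by
  unfold W
  rw [Finset.mul_sum]
  apply Finset.sum_le_sum
  intro i _
  rw [sq]
  exact mul_le_mul_of_nonneg_right (hmax i) (hw i)

/-! ## Rev 2 — the trivial CEILING `C(N) ≤ #κ` (so the E108 statistic lives in `[max(1, (w_max/W)·#κ), #κ]`) -/

/-- **Ceiling (no large sieve needed)**: `Q w u a ≤ W · #κ · ‖a‖²`, i.e. `C(N) = sup_a Q/(W‖a‖²) ≤ #κ` — Cauchy–Schwarz
in the inner sum, `|Σ_n conj(u i n)·a n|² ≤ (Σ_n ‖a n‖)² ≤ #κ·‖a‖²` for unit-modulus `u`. Together with the floors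
above, every E108 row's level satisfies `max(1, (w_max/W)·#κ) ≤ C(N) ≤ #κ` by linear algebra alone; a row's
ratio `r = C/((w_max/W)·#κ)` is therefore `≤ W/w_max`. [cite: Zhang2022LandauSiegel, §2 (2.16); §7 (7.2) p.44] -/
theorem Q_le_card_mul_nsq {w : ι → ℝ} (hw : ∀ i, 0 ≤ w i) {u : ι → κ → ℂ} (hu : UnitModulus u) (a : κ → ℂ) :
    Q w u a ≤ W w * (Fintype.card κ : ℝ) * nsq a := by
  unfold Q W nsq
  have hcs : ∀ i, ‖∑ n, conj (u i n) * a n‖ ^ 2 ≤ (Fintype.card κ : ℝ) * ∑ n, ‖a n‖ ^ 2 := by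
    intro i
    have h1 : ‖∑ n, conj (u i n) * a n‖ ≤ ∑ n, (1 : ℝ) * ‖a n‖ :=
      (norm_sum_le _ _).trans (le_of_eq (Finset.sum_congr rfl fun n _ => by
        rw [norm_mul, Complex.norm_conj, hu i n]))
    have h2 := Finset.sum_mul_sq_le_sq_mul_sq Finset.univ (fun _ => (1 : ℝ)) (fun n => ‖a n‖)
    simp only [one_pow, Finset.sum_const, Finset.card_univ, nsmul_eq_mul, mul_one] at h2
    exact (pow_le_pow_left₀ (norm_nonneg _) h1 2).trans h2
  calc ∑ i, w i * ‖∑ n, conj (u i n) * a n‖ ^ 2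
      ≤ ∑ i, w i * ((Fintype.card κ : ℝ) * ∑ n, ‖a n‖ ^ 2) :=
        Finset.sum_le_sum fun i _ => mul_le_mul_of_nonneg_left (hcs i) (hw i)
    _ = (∑ i, w i) * (Fintype.card κ : ℝ) * ∑ n, ‖a n‖ ^ 2 := by rw [← Finset.sum_mul]; ring

/-- The ceiling in ratio form: for `a ≠ 0` and `W > 0`, `Q/(W·‖a‖²) ≤ #κ`.
[cite: Zhang2022LandauSiegel, §2 (2.16); §7 (7.2) p.44] -/
theorem rayleigh_le_card {w : ι → ℝ} (hw : ∀ i, 0 ≤ w i) (hW : 0 < W w) {u : ι → κ → ℂ} (hu : UnitModulus u)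
    {a : κ → ℂ} (ha : 0 < nsq a) : Q w u a / (W w * nsq a) ≤ (Fintype.card κ : ℝ) := by
  rw [div_le_iff₀ (mul_pos hW ha)]
  calc Q w u a ≤ W w * (Fintype.card κ : ℝ) * nsq a := Q_le_card_mul_nsq hw hu a
    _ = (Fintype.card κ : ℝ) * (W w * nsq a) := by ring

end Literature.NumberTheory.LFunctions.Zhang2022.Repair.Bed.E108

end
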